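import Summits.HubbardSuperconductivity.HubbardSuperconductivity.Theses.NodalWardXY

/-!
# Disproof of `PerturbedXYOrder` (crux stmt-HubbardSuperconductivity-10739) — work file

Findings index (refuter-cdisprove, cycle 1):
* §0 vocabulary: the crux restated over named pieces (`cube`, `cur`, `wJ`, `Wk`, `Zk`, `plateau`,
  `Admissible`); `perturbedXYOrder_iff` is `Iff.rfl`, so provers may `rw` into this vocabulary.
* §1 deterministic structure (proved): the relative form bound
  `‖W_K θ‖ ≤ ε Σ_b D_L(b) j_b(θ)²`, `j_b² ≤ 2(1 - cos ∇_b θ)` — the perturbation is bounded by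
  `(2 ε S_L / J) ×` the XY energy above the ground state (Balaban small/large-field form, no `|Λ|`
  term). Consequence (proved): small-volume zero-freeness — if `ε Σ_{b,b'} (1+d)⁻⁴ < π/2` then
  `Re (w_J e^{W_K}) > 0` pointwise and `Z_K ≠ 0`; so conjunct 1 has NO counterexample with
  `9 ε L⁶ < π/2` (any zero of `Z_K` needs `L ≳ ε^{-1/6}`, in fact `L ≳ (ε S_L)^{-1/3}`).
* §2 load-bearing analysis: variants `Exp p` (exponent; `p ≤ 3` FALSE on paper), `AllJ` (no
  low-temperature window; FALSE — PROVED and landed as the negative lemma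
  `Theorems/PerturbedXYOrder/Negative/HighTemperatureNoPlateau.lean`, p73198), `Real` (real slice),
  `LargeEps` (every `ε`; plausible, and what NodalReduction morally consumes).
* §3a extensiveness (proved): the admissible imaginary diagonal kernel `Kdiag = iε δ_{bb'}`
  (K3's probe) has `W = iε Σ_b j_b²` and reaches `‖W‖ = 3 ε L³` on the 90°-helix (`4 ∣ L`,
  `cur_helix`, `exists_norm_Wk_ge`): `e^{W_K}` is nowhere near `1`, no termwise route to `Z_K ≠ 0`.
* §3 strengthenings that are FALSE (paper) · §4 numerics (kit j007909 DONE: Gaussian law |Z_K/Z_0| = exp(-ε²VarQ/2) confirmed, plateau within 0.075 of m₀² on resolved points; j009085, j013776 queued) ·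
  Targets: none yet (no skeleton / stuck stubs at cycle 1) · §5 WHY IT RESISTS (closing block).
-/

set_option linter.dupNamespace false

namespace Summit.HubbardSuperconductivity.HubbardSuperconductivity.Cruxes.PerturbedXYOrder.Disproof

open scoped BigOperators
open MeasureTheory Literature.Probability.LatticeModels
open Summit.HubbardSuperconductivity.HubbardSuperconductivity.Theses.NodalWardXY

noncomputable section

/-! ## §0 Vocabulary -/

/-- Sites of the torus `(ℤ/Lℤ)³`. -/
abbrev Λ (L : ℕ) : Type := TorusSite 3 L
/-- Directed bonds `b = (x, i)`, from `x` to `x + e_i`. -/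
abbrev Bond (L : ℕ) : Type := TorusSite 3 L × Fin 3

/-- The configuration cube `[0, 2π]^Λ`. -/
def cube (L : ℕ) : Set (Λ L → ℝ) := Set.pi Set.univ (fun _ => Set.Icc (0:ℝ) (2 * Real.pi))

/-- The bond current `j_b(θ) = sin(θ_{x+e_i} - θ_x)`. -/
def cur {L : ℕ} (b : Bond L) (θ : Λ L → ℝ) : ℝ := Real.sin (θ (b.1 + Pi.single b.2 1) - θ b.1)

/-- The ferromagnetic XY weight `w_J(θ) = exp(J Σ_b cos ∇_b θ)` (as a complex number). -/
def wJ {L : ℕ} [NeZero L] (J : ℝ) (θ : Λ L → ℝ) : ℂ :=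
  ((Real.exp (J * ∑ b : Bond L, Real.cos (θ (b.1 + Pi.single b.2 1) - θ b.1)) : ℝ) : ℂ)

/-- The complex two-current perturbation `W_K(θ) = Σ_{b,b'} K(b,b') j_b j_{b'}`. -/
def Wk {L : ℕ} [NeZero L] (K : Bond L → Bond L → ℂ) (θ : Λ L → ℝ) : ℂ :=
  ∑ b, ∑ b', K b b' * (cur b θ : ℂ) * (cur b' θ : ℂ)

/-- The perturbed partition function `Z_K = ∫_cube w_J e^{W_K}`. -/
def Zk {L : ℕ} [NeZero L] (J : ℝ) (K : Bond L → Bond L → ℂ) : ℂ :=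
  MeasureTheory.integral (MeasureTheory.volume.restrict (cube L)) (fun θ => wJ J θ * Complex.exp (Wk K θ))

/-- The un-normalised magnetisation numerator `Σ_{x,y} ∫ cos(θ_x - θ_y) w_J e^{W_K}`. -/
def num {L : ℕ} [NeZero L] (J : ℝ) (K : Bond L → Bond L → ℂ) : ℂ :=
  ∑ x : Λ L, ∑ y : Λ L, MeasureTheory.integral (MeasureTheory.volume.restrict (cube L))
    (fun θ => (Real.cos (θ x - θ y) : ℂ) * (wJ J θ * Complex.exp (Wk K θ)))

/-- The plateau `Re[num / Z_K / L⁶]`. -/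
def plateau (L : ℕ) [NeZero L] (J : ℝ) (K : Bond L → Bond L → ℂ) : ℝ :=
  (num J K / Zk J K / ((L : ℂ) ^ 6)).re

/-- Admissible kernels: `‖K(b,b')‖ ≤ ε (1 + dist(x,x'))⁻⁴`. -/
def Admissible (L : ℕ) [NeZero L] (ε : ℝ) (K : Bond L → Bond L → ℂ) : Prop :=
  ∀ b b', ‖K b b'‖ ≤ ε / (1 + ((torusGraph 3 L).dist b.1 b'.1 : ℝ)) ^ 4

/-- The crux in this vocabulary (definitional). -/
theorem perturbedXYOrder_iff :
    PerturbedXYOrder ↔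
      ∃ J₀ ε a : ℝ, 0 < ε ∧ 0 < a ∧ ∀ J : ℝ, J₀ ≤ J → ∀ (L : ℕ) [NeZero L], 2 ≤ L →
        ∀ K : Bond L → Bond L → ℂ, Admissible L ε K → Zk J K ≠ 0 ∧ a ≤ plateau L J K :=
  Iff.rfl


/-! ## §1 Deterministic structure: relative form bound and small-volume zero-freeness -/

variable {L : ℕ}

/-- `j_b(θ)² ≤ 2 (1 - cos ∇_b θ)`: the squared current is dominated by (twice) the bond energy
above the ground state (`sin² φ = (1 - cos φ)(1 + cos φ)`). -/
theorem sq_cur_le (b : Bond L) (θ : Λ L → ℝ) :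
    (cur b θ) ^ 2 ≤ 2 * (1 - Real.cos (θ (b.1 + Pi.single b.2 1) - θ b.1)) := by
  unfold cur
  set φ := θ (b.1 + Pi.single b.2 1) - θ b.1
  nlinarith [Real.sin_sq_add_cos_sq φ, sq_nonneg (1 - Real.cos φ)]

/-- `|j_b| ≤ 1`. -/
theorem abs_cur_le_one (b : Bond L) (θ : Λ L → ℝ) : |cur b θ| ≤ 1 := Real.abs_sin_le_one _

/-- The decay envelope `(1 + dist(x,x'))⁻⁴` of admissible kernels. -/
def dk (L : ℕ) (b b' : Bond L) : ℝ := 1 / (1 + ((torusGraph 3 L).dist b.1 b'.1 : ℝ)) ^ 4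

theorem dk_comm (b b' : Bond L) : dk L b b' = dk L b' b := by
  unfold dk; rw [SimpleGraph.dist_comm]

theorem dk_nonneg (b b' : Bond L) : 0 ≤ dk L b b' := by unfold dk; positivity

theorem dk_le_one (b b' : Bond L) : dk L b b' ≤ 1 := by
  unfold dk
  rw [div_le_one (by positivity)]
  have h : (0:ℝ) ≤ ((torusGraph 3 L).dist b.1 b'.1 : ℝ) := by positivity
  exact one_le_pow₀ (by linarith)

/-- Every admissible `ε` is non-negative as soon as `L ≠ 0` (bonds exist). -/
theorem Admissible.eps_nonneg [NeZero L] {ε : ℝ} {K : Bond L → Bond L → ℂ}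
    (hK : Admissible L ε K) : 0 ≤ ε := by
  have b : Bond L := ((fun _ => 0), 0)
  have h := hK b b
  have hd : (0:ℝ) < (1 + ((torusGraph 3 L).dist b.1 b.1 : ℝ)) ^ 4 := by positivity
  have : 0 ≤ ε / (1 + ((torusGraph 3 L).dist b.1 b.1 : ℝ)) ^ 4 := (norm_nonneg _).trans h
  exact (div_nonneg_iff.1 this).elim (fun h => h.1) (fun h => absurd h.2 (not_le.2 hd))

/-- Termwise bound `‖K(b,b') j_b j_b'‖ ≤ ε dk(b,b') |j_b| |j_b'|`. -/
theorem norm_term_le [NeZero L] {ε : ℝ} {K : Bond L → Bond L → ℂ} (hK : Admissible L ε K)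
    (θ : Λ L → ℝ) (b b' : Bond L) :
    ‖K b b' * (cur b θ : ℂ) * (cur b' θ : ℂ)‖ ≤ ε * dk L b b' * (|cur b θ| * |cur b' θ|) := by
  rw [norm_mul, norm_mul, Complex.norm_real, Complex.norm_real, Real.norm_eq_abs,
    Real.norm_eq_abs]
  have h1 : ‖K b b'‖ ≤ ε * dk L b b' := by rw [dk, mul_one_div]; exact hK b b'
  calc ‖K b b'‖ * |cur b θ| * |cur b' θ| = ‖K b b'‖ * (|cur b θ| * |cur b' θ|) := by ring
    _ ≤ ε * dk L b b' * (|cur b θ| * |cur b' θ|) := by gcongr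

/-- CRUDE pointwise bound: `‖W_K(θ)‖ ≤ ε Σ_{b,b'} (1+dist)⁻⁴` (uses only `|j_b| ≤ 1`). -/
theorem norm_Wk_le_sum_dk [NeZero L] {ε : ℝ} {K : Bond L → Bond L → ℂ} (hK : Admissible L ε K)
    (θ : Λ L → ℝ) : ‖Wk K θ‖ ≤ ε * ∑ b : Bond L, ∑ b' : Bond L, dk L b b' := by
  have hε := hK.eps_nonneg
  unfold Wk
  calc ‖∑ b, ∑ b', K b b' * (cur b θ : ℂ) * (cur b' θ : ℂ)‖
      ≤ ∑ b, ‖∑ b', K b b' * (cur b θ : ℂ) * (cur b' θ : ℂ)‖ := norm_sum_le _ _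
    _ ≤ ∑ b, ∑ b', ‖K b b' * (cur b θ : ℂ) * (cur b' θ : ℂ)‖ :=
        Finset.sum_le_sum fun b _ => norm_sum_le _ _
    _ ≤ ∑ b, ∑ b', ε * dk L b b' := by
        gcongr with b _ b' _
        calc _ ≤ ε * dk L b b' * (|cur b θ| * |cur b' θ|) := norm_term_le hK θ b b'
          _ ≤ ε * dk L b b' * (1 * 1) :=
              mul_le_mul_of_nonneg_left
                (mul_le_mul (abs_cur_le_one b θ) (abs_cur_le_one b' θ) (abs_nonneg _) zero_le_one)
                (mul_nonneg hε (dk_nonneg b b'))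
          _ = ε * dk L b b' := by ring
    _ = ε * ∑ b, ∑ b', dk L b b' := by simp [Finset.mul_sum]

/-- The envelope double sum is at most `(3 L³)² = 9 L⁶` (number of bond pairs). -/
theorem sum_dk_le [NeZero L] : ∑ b : Bond L, ∑ b' : Bond L, dk L b b' ≤ 9 * (L : ℝ) ^ 6 := by
  calc ∑ b : Bond L, ∑ b' : Bond L, dk L b b' ≤ ∑ b : Bond L, ∑ b' : Bond L, (1:ℝ) := by
        gcongr with b _ b' _; exact dk_le_one b b'
    _ = 9 * (L : ℝ) ^ 6 := by
        simp only [Finset.sum_const, Finset.card_univ, nsmul_eq_mul, mul_one, Fintype.card_prod,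
          Fintype.card_fin, Fintype.card_fun, ZMod.card]
        push_cast
        ring

/-- RELATIVE FORM BOUND (the informal statement's "|W_K| ≤ 2 ε C₃ Σ_b (1 - cos ∇_b θ)"):
`‖W_K(θ)‖ ≤ ε Σ_b D_L(b) j_b(θ)²` with `D_L(b) = Σ_{b'} (1+dist)⁻⁴`, by `|j j'| ≤ (j² + j'²)/2`
and the symmetry of the graph distance. Combined with `sq_cur_le` this is
`‖W_K‖ ≤ (2 ε sup_b D_L(b) / J) · J Σ_b (1 - cos ∇_b θ)`: the perturbation is form-bounded by the
XY energy above the ground state with relative constant `O(ε/J)` — which is why every cheap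
energetic attack (spirals, staggered currents, vortices; §2) is defused by `J₀ ≫ ε`. -/
theorem norm_Wk_le_energy [NeZero L] {ε : ℝ} {K : Bond L → Bond L → ℂ} (hK : Admissible L ε K)
    (θ : Λ L → ℝ) :
    ‖Wk K θ‖ ≤ ε * ∑ b : Bond L, (∑ b' : Bond L, dk L b b') * (cur b θ) ^ 2 := by
  have hε := hK.eps_nonneg
  unfold Wk
  have key : ∀ b b', ‖K b b' * (cur b θ : ℂ) * (cur b' θ : ℂ)‖
      ≤ ε * dk L b b' * (cur b θ) ^ 2 / 2 + ε * dk L b b' * (cur b' θ) ^ 2 / 2 := by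
    intro b b'
    calc _ ≤ ε * dk L b b' * (|cur b θ| * |cur b' θ|) := norm_term_le hK θ b b'
      _ ≤ ε * dk L b b' * (((cur b θ) ^ 2 + (cur b' θ) ^ 2) / 2) := by
          gcongr
          · exact mul_nonneg hε (dk_nonneg b b')
          · nlinarith [sq_nonneg (|cur b θ| - |cur b' θ|), sq_abs (cur b θ), sq_abs (cur b' θ)]
      _ = _ := by ring
  have swap : ∑ b : Bond L, ∑ b' : Bond L, ε * dk L b b' * (cur b' θ) ^ 2 / 2
      = ∑ b : Bond L, ∑ b' : Bond L, ε * dk L b b' * (cur b θ) ^ 2 / 2 := by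
    rw [Finset.sum_comm]
    refine Finset.sum_congr rfl fun b _ => Finset.sum_congr rfl fun b' _ => ?_
    rw [dk_comm b' b]
  calc ‖∑ b, ∑ b', K b b' * (cur b θ : ℂ) * (cur b' θ : ℂ)‖
      ≤ ∑ b, ‖∑ b', K b b' * (cur b θ : ℂ) * (cur b' θ : ℂ)‖ := norm_sum_le _ _
    _ ≤ ∑ b, ∑ b', ‖K b b' * (cur b θ : ℂ) * (cur b' θ : ℂ)‖ :=
        Finset.sum_le_sum fun b _ => norm_sum_le _ _
    _ ≤ ∑ b, ∑ b', (ε * dk L b b' * (cur b θ) ^ 2 / 2 + ε * dk L b b' * (cur b' θ) ^ 2 / 2) := by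
        gcongr with b _ b' _; exact key b b'
    _ = ∑ b, ∑ b', ε * dk L b b' * (cur b θ) ^ 2 / 2
        + ∑ b, ∑ b', ε * dk L b b' * (cur b' θ) ^ 2 / 2 := by
        simp only [Finset.sum_add_distrib]
    _ = ∑ b, ∑ b', ε * dk L b b' * (cur b θ) ^ 2 / 2
        + ∑ b, ∑ b', ε * dk L b b' * (cur b θ) ^ 2 / 2 := by rw [swap]
    _ = ∑ b, ∑ b', ε * dk L b b' * (cur b θ) ^ 2 := by
        rw [← Finset.sum_add_distrib]
        refine Finset.sum_congr rfl fun b _ => ?_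
        rw [← Finset.sum_add_distrib]
        refine Finset.sum_congr rfl fun b' _ => ?_
        ring
    _ = ε * ∑ b, (∑ b', dk L b b') * (cur b θ) ^ 2 := by
        rw [Finset.mul_sum]
        refine Finset.sum_congr rfl fun b _ => ?_
        rw [Finset.sum_mul, Finset.mul_sum]
        refine Finset.sum_congr rfl fun b' _ => ?_
        ring

/-- Pointwise positivity of the real part of the perturbed weight when the TOTAL envelope mass is
below `π/2`: then `|Im W_K| < π/2` and `Re (w_J e^{W_K}) = e^{J Σ cos} e^{Re W} cos(Im W) > 0`. -/
theorem re_weight_pos [NeZero L] {ε : ℝ} {K : Bond L → Bond L → ℂ} (hK : Admissible L ε K)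
    (hsmall : ε * ∑ b : Bond L, ∑ b' : Bond L, dk L b b' < Real.pi / 2) (J : ℝ) (θ : Λ L → ℝ) :
    0 < (wJ J θ * Complex.exp (Wk K θ)).re := by
  have him : |(Wk K θ).im| < Real.pi / 2 :=
    lt_of_le_of_lt ((Complex.abs_im_le_norm _).trans (norm_Wk_le_sum_dk hK θ)) hsmall
  unfold wJ
  rw [Complex.re_ofReal_mul, Complex.exp_re]
  refine mul_pos (Real.exp_pos _) (mul_pos (Real.exp_pos _) (Real.cos_pos_of_mem_Ioo ?_))
  exact ⟨by linarith [(abs_lt.1 him).1], (abs_lt.1 him).2⟩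

/-- The perturbed integrand is continuous in `θ`. -/
theorem continuous_weight [NeZero L] (J : ℝ) (K : Bond L → Bond L → ℂ) :
    Continuous fun θ : Λ L → ℝ => wJ J θ * Complex.exp (Wk K θ) := by
  unfold wJ Wk cur
  fun_prop

/-- The cube `[0,2π]^Λ` is compact and has positive Lebesgue measure. -/
theorem isCompact_cube : IsCompact (cube L) := isCompact_univ_pi fun _ => isCompact_Icc

theorem volume_cube_pos [NeZero L] : 0 < MeasureTheory.volume (cube L) := by
  unfold cube
  rw [MeasureTheory.volume_pi_pi]
  refine pos_iff_ne_zero.2 (Finset.prod_ne_zero_iff.2 fun x _ => ?_)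
  rw [Real.volume_Icc]
  exact (ENNReal.ofReal_pos.2 (by linarith [Real.pi_pos])).ne'

/-- SMALL-VOLUME ZERO-FREENESS: if the total envelope mass `ε Σ_{b,b'} (1+dist)⁻⁴` is below
`π/2`, the perturbed partition function has positive real part, hence `Z_K ≠ 0`, for EVERY real
`J` and every admissible `K`. With `sum_dk_le` this covers all `L` with `9 ε L⁶ < π/2`; with the
sharper lattice sum `Σ_{b'} (1+dist)⁻⁴ ≤ 3 S_∞`, `S_∞ = 2.4572` (evidence-10739.md) it covers
`27 ε S_∞ L³ < π/2`. Any counterexample to conjunct 1 therefore needs `L ≳ (ε S_∞)^{-1/3}`, an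
`L³`-dimensional oscillatory integral: not certifiable by computation, and see §5 for why no
symmetry forces an exact zero. -/
theorem Zk_re_pos_of_pointwise [NeZero L] {K : Bond L → Bond L → ℂ} (J : ℝ)
    (hpos : ∀ θ, 0 < (wJ J θ * Complex.exp (Wk K θ)).re) : 0 < (Zk J K).re := by
  set f : (Λ L → ℝ) → ℂ := fun θ => wJ J θ * Complex.exp (Wk K θ) with hf
  have hint : Integrable f (volume.restrict (cube L)) :=
    (continuous_weight J K).continuousOn.integrableOn_compact isCompact_cube
  have hre : (Zk J K).re = ∫ θ, (f θ).re ∂(volume.restrict (cube L)) := by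
    unfold Zk
    rw [← Complex.reCLM_apply, ← ContinuousLinearMap.integral_comp_comm _ hint]
    rfl
  rw [hre, integral_pos_iff_support_of_nonneg (fun θ => (hpos θ).le)]
  · have hsupp : Function.support (fun θ => (f θ).re) = Set.univ :=
      Set.eq_univ_of_forall fun θ => (hpos θ).ne'
    rw [hsupp, Measure.restrict_apply_univ]
    exact volume_cube_pos
  · exact (Complex.reCLM.integrable_comp hint : _)

theorem Zk_re_pos_of_small [NeZero L] {ε : ℝ} {K : Bond L → Bond L → ℂ} (hK : Admissible L ε K)
    (hsmall : ε * ∑ b : Bond L, ∑ b' : Bond L, dk L b b' < Real.pi / 2) (J : ℝ) :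
    0 < (Zk J K).re :=
  Zk_re_pos_of_pointwise J (re_weight_pos hK hsmall J)

/-- REAL SLICE: for real-valued kernels (any size, any decay) `W_K` is real, the weight is
positive and `Re Z_K > 0`: conjunct 1 is trivial on the real slice, all of its content is in
`Im K`; conjunct 2 on the real slice is LRO for an honest (positive, non-RP, non-Ginibre)
Gibbs measure — open in print but attack-free (§2). -/
theorem Wk_im_of_real [NeZero L] {K : Bond L → Bond L → ℂ} (hK : ∀ b b', (K b b').im = 0)
    (θ : Λ L → ℝ) : (Wk K θ).im = 0 := by
  unfold Wk
  simp [Complex.im_sum, Complex.mul_im, hK]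

theorem Zk_re_pos_of_real [NeZero L] {K : Bond L → Bond L → ℂ} (hK : ∀ b b', (K b b').im = 0)
    (J : ℝ) : 0 < (Zk J K).re := by
  refine Zk_re_pos_of_pointwise J fun θ => ?_
  unfold wJ
  rw [Complex.re_ofReal_mul, Complex.exp_re, Wk_im_of_real hK θ, Real.cos_zero, mul_one]
  exact mul_pos (Real.exp_pos _) (Real.exp_pos _)

theorem Zk_ne_zero_of_small [NeZero L] {ε : ℝ} {K : Bond L → Bond L → ℂ} (hK : Admissible L ε K)
    (hsmall : ε * ∑ b : Bond L, ∑ b' : Bond L, dk L b b' < Real.pi / 2) (J : ℝ) :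
    Zk J K ≠ 0 := fun h => by
  have := Zk_re_pos_of_small hK hsmall J
  rw [h, Complex.zero_re] at this
  exact lt_irrefl _ this

/-- Corollary in closed form: conjunct 1 of the crux holds whenever `9 ε L⁶ < π/2`. -/
theorem Zk_ne_zero_of_small_volume [NeZero L] {ε : ℝ} {K : Bond L → Bond L → ℂ}
    (hK : Admissible L ε K) (hL : 9 * ε * (L : ℝ) ^ 6 < Real.pi / 2) (J : ℝ) : Zk J K ≠ 0 := by
  refine Zk_ne_zero_of_small hK (lt_of_le_of_lt ?_ hL) J
  calc ε * ∑ b : Bond L, ∑ b' : Bond L, dk L b b' ≤ ε * (9 * (L : ℝ) ^ 6) := by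
        gcongr
        · exact hK.eps_nonneg
        · exact sum_dk_le
    _ = 9 * ε * (L : ℝ) ^ 6 := by ring

/-! ## §2 Load-bearing analysis (variants of the crux; paper verdicts in the docstrings)

Conventions: "paper" = argument recorded here but not formalised (reason given); "proved" =
theorem in this file; kit job ids refer to `kit compute` runs attached to the item. -/

/-- Admissibility with a general decay exponent `p` (the crux has `p = 4`). -/
def AdmissibleExp (L : ℕ) [NeZero L] (p : ℕ) (ε : ℝ) (K : Bond L → Bond L → ℂ) : Prop :=
  ∀ b b', ‖K b b'‖ ≤ ε / (1 + ((torusGraph 3 L).dist b.1 b'.1 : ℝ)) ^ p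

/-- VARIANT `Exp p`: the crux with envelope `(1+dist)^{-p}`.
* `p = 4` is the crux (`perturbedXYOrder_iff_exp_four`); `p ↦ PerturbedXYOrderExp p` is monotone
  (`PerturbedXYOrderExp.mono`: larger `p` = smaller kernel class = weaker claim).
* PAPER VERDICT `p ≤ 3` (in particular the bare bound `p = 0`, `‖K‖ ≤ ε`): FALSE for every
  choice of `J₀, ε, a`. Witness: `J = J₀`, `L = 4m`, the REAL all-pairs kernel
  `K_L(b,b') = ε (1+dist)^{-p}`. Then `W_K(θ) = ε Σ_{b,b'} (1+d)^{-p} j_b j_b' ≤ 9 ε σ_L(p) L³`,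
  `σ_L(p) = Σ_{x'} (1+dist(0,x'))^{-p}`, with equality iff all `j_b = 1`, i.e. on the 90°-helix
  `θ_x = (π/2)(x₁+x₂+x₃) + c` (torus-compatible since `4 ∣ L`), which has magnetisation `m = 0`.
  For `p ≤ 3`, `σ_L(p) → ∞` (`≈ 4 log L` at `p = 3`), so for `L ≥ exp(c J₀/ε)` the positive measure
  `e^{J Σ cos + W_K}/Z_K` is dominated by the `W` term (`9εσ_L L³ ≫ 6 J L³`) and concentrates
  (Laplace, with the rigidity `Σ k j j' ≤ 9εσ_L L³ - c(a) ε σ_L L³` on `{|m|² ≥ a}`) where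
  `|m|² < a`: the plateau drops below `a`. Not formalised: needs quantitative Laplace
  concentration on `[0,2π]^{L³}` with `L` growing like `exp(J₀/ε)`; no finite certificate.
  (This is evidence-10739.md's "exponent 4 is load-bearing", made into a concrete witness.)
* `p ≥ 4` (summable tails, `σ_∞(4) = S_∞ ≈ 2.4572`): every energetic attack is defused by
  `J₀ ≥ 5 ε S_∞` (form bound `norm_Wk_le_energy`); see §5. -/
def PerturbedXYOrderExp (p : ℕ) : Prop :=
  ∃ J₀ ε a : ℝ, 0 < ε ∧ 0 < a ∧ ∀ J : ℝ, J₀ ≤ J → ∀ (L : ℕ) [NeZero L], 2 ≤ L →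
    ∀ K : Bond L → Bond L → ℂ, AdmissibleExp L p ε K → Zk J K ≠ 0 ∧ a ≤ plateau L J K

theorem perturbedXYOrder_iff_exp_four : PerturbedXYOrder ↔ PerturbedXYOrderExp 4 := Iff.rfl

theorem AdmissibleExp.of_le [NeZero L] {p q : ℕ} (hpq : p ≤ q) {ε : ℝ} (hε : 0 ≤ ε)
    {K : Bond L → Bond L → ℂ} (hK : AdmissibleExp L q ε K) : AdmissibleExp L p ε K := by
  intro b b'
  refine (hK b b').trans ?_
  have h1 : (1:ℝ) ≤ 1 + ((torusGraph 3 L).dist b.1 b'.1 : ℝ) := by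
    have : (0:ℝ) ≤ ((torusGraph 3 L).dist b.1 b'.1 : ℝ) := by positivity
    linarith
  exact div_le_div_of_nonneg_left hε (by positivity) (pow_le_pow_right₀ h1 hpq)

/-- Monotonicity of the variant family in the exponent. -/
theorem PerturbedXYOrderExp.mono {p q : ℕ} (hpq : p ≤ q) (h : PerturbedXYOrderExp p) :
    PerturbedXYOrderExp q := by
  obtain ⟨J₀, ε, a, hε, ha, h⟩ := h
  exact ⟨J₀, ε, a, hε, ha, fun J hJ L _ hL K hK => h J hJ L hL K (hK.of_le hpq hε.le)⟩

/-- VARIANT `AllJ`: the crux without the low-temperature hypothesis `J₀ ≤ J`.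
VERDICT: FALSE twice over. (i) PROVED (landed as the negative lemma
`Theorems/PerturbedXYOrder/Negative/HighTemperatureNoPlateau.lean`, proposal p73198,
`perturbedXYOrder_false_without_lowT : ¬ PerturbedXYOrderAllJ`-verbatim): conjunct 2 at `J = 0`,
`K = 0`, `L = max 2 (⌈1/a⌉₊+1)` — independent uniform angles, the off-diagonal two-point function
vanishes by Fubini on `[0,2π]^Λ` and `plateau = L⁻³ < a` exactly. Physics-free ("high temperature
has no order"), but it pins the normalisation: the diagonal alone contributes `L⁻³`.
(ii) PAPER: conjunct 1 at `J = J_c ≈ 0.4542` (3D XY critical coupling): the imaginary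
diagonal kernel `K = iη δ_{bb'}` is an energy-like, O(2)-even perturbation with non-zero overlap
on the thermal scaling field, so `Z_{iη}` has Fisher-type zeros at `η ~ c L^{-1/ν} → 0`
(finite-size scaling of partition-function zeros; for the 3D XY universality class computed
numerically by Gottlob–Hasenbusch 1993) — for every fixed `ε` some `L` puts a zero inside the
disc. Hence ANY proof of conjunct 1 must use `J₀ > J_c`, not merely `J₀ ≥ 0`: zero-freeness is a
property of the massless ORDERED phase, exactly Balaban's regime. -/
def PerturbedXYOrderAllJ : Prop :=
  ∃ ε a : ℝ, 0 < ε ∧ 0 < a ∧ ∀ J : ℝ, ∀ (L : ℕ) [NeZero L], 2 ≤ L →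
    ∀ K : Bond L → Bond L → ℂ, Admissible L ε K → Zk J K ≠ 0 ∧ a ≤ plateau L J K

theorem perturbedXYOrderAllJ_imp : PerturbedXYOrderAllJ → PerturbedXYOrder := by
  rintro ⟨ε, a, hε, ha, h⟩
  exact ⟨0, ε, a, hε, ha, fun J _ L _ hL K hK => h J L hL K hK⟩

/-- VARIANT `Real`: kernels restricted to the real slice `Im K = 0`. Conjunct 1 is then trivial
(`Zk_re_pos_of_real`, proved: positive weights). Conjunct 2 is LRO at low temperature for the
positive Gibbs measure `∝ exp(J Σ cos ∇θ + Σ K j j')`: not reflection positive (non-nearest-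
neighbour, mixed-sign two-current couplings), not Ginibre-ferromagnetic
(`sin a sin b = [cos(a-b) - cos(a+b)]/2` carries a negative coefficient), so neither
FSS76/Giuliani–Ott nor correlation-inequality monotonicity applies; unprinted but no attack:
the form bound makes it a `O(ε/J)`-relative perturbation of the stiffness. The crux is therefore
"Real slice (positivity-free LRO, Balaban class) + analytic continuation in `K` to the polydisc
(uniform zero-freeness)"; the second half is where kill criterion K3 lives. -/
def PerturbedXYOrderReal : Prop :=
  ∃ J₀ ε a : ℝ, 0 < ε ∧ 0 < a ∧ ∀ J : ℝ, J₀ ≤ J → ∀ (L : ℕ) [NeZero L], 2 ≤ L →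
    ∀ K : Bond L → Bond L → ℂ, (∀ b b', (K b b').im = 0) → Admissible L ε K →
      Zk J K ≠ 0 ∧ a ≤ plateau L J K

theorem perturbedXYOrder_imp_real : PerturbedXYOrder → PerturbedXYOrderReal := by
  rintro ⟨J₀, ε, a, hε, ha, h⟩
  exact ⟨J₀, ε, a, hε, ha, fun J hJ L _ hL K _ hK => h J hJ L hL K hK⟩

/-- STRENGTHENING `LargeEps` (recorded, not attacked): `∀ ε > 0 ∃ J₀ a > 0 …` — smallness of `ε`
is NOT load-bearing in absolute terms, only relative to `J`: all attacks of §5 are governed by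
`ε S_∞ / J`. The helix energetics show `J₀(ε) ≥ 2 ε S_L` is necessary for the real direction-
diagonal kernel (spiral instability of `q = 0` iff `J < 2 ε S_L ≤ 4.92 ε`, evidence-10739.md), so
the natural conjecture is `J₀(ε) = max(J_*, C ε)`. Provers: do not try to take `J₀` independent
of `ε` in intermediate lemmas.
ROUTE-LEVEL REMARK (for planners, not a defect of the crux): as filed, the crux offers `∃ ε`
with no formula, which is WEAK FOR CONSUMPTION — `NodalReduction` receives an unknown `ε` and must
fit the nodal two-current kernel (a definite, `Δ₀`-dependent relative size `ε_phys/J`, scale-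
invariant under blocking since both the stiffness and the `|X|⁻⁴` two-current term have classical
dimension `d - 2 = 1`) inside it; that is only possible if the reduction can make the effective
relative coupling arbitrarily small. `LargeEps` (every `ε`, with `J₀ = J₀(ε)`) is what the
mechanism morally consumes. -/
def PerturbedXYOrderLargeEps : Prop :=
  ∀ ε : ℝ, 0 < ε → ∃ J₀ a : ℝ, 0 < a ∧ ∀ J : ℝ, J₀ ≤ J → ∀ (L : ℕ) [NeZero L], 2 ≤ L →
    ∀ K : Bond L → Bond L → ℂ, Admissible L ε K → Zk J K ≠ 0 ∧ a ≤ plateau L J K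

theorem perturbedXYOrderLargeEps_imp : PerturbedXYOrderLargeEps → PerturbedXYOrder := by
  intro h
  obtain ⟨J₀, a, ha, h1⟩ := h 1 one_pos
  exact ⟨J₀, 1, a, one_pos, ha, h1⟩

/-! ## §3a Extensiveness of `W_K` (proved): the imaginary diagonal kernel on the 90°-helix -/

/-- The imaginary diagonal kernel `K = iε δ_{bb'}` (the probe of kill criterion K3). -/
def Kdiag (L : ℕ) (ε : ℝ) (b b' : Bond L) : ℂ := if b = b' then (ε : ℂ) * Complex.I else 0

theorem admissible_Kdiag [NeZero L] {ε : ℝ} (hε : 0 ≤ ε) : Admissible L ε (Kdiag L ε) := by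
  intro b b'
  unfold Kdiag
  split_ifs with h
  · subst h
    rw [SimpleGraph.dist_self]
    simp [Complex.norm_real, abs_of_nonneg hε]
  · rw [norm_zero]; positivity

/-- `W_{Kdiag} = iε Σ_b j_b²`. -/
theorem Wk_Kdiag [NeZero L] (ε : ℝ) (θ : Λ L → ℝ) :
    Wk (Kdiag L ε) θ = ((ε * ∑ b : Bond L, (cur b θ) ^ 2 : ℝ) : ℂ) * Complex.I := by
  unfold Wk Kdiag
  simp only [ite_mul, zero_mul, Finset.sum_ite_eq, Finset.mem_univ, if_true]
  push_cast
  rw [Finset.mul_sum, Finset.sum_mul]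
  refine Finset.sum_congr rfl fun b _ => ?_
  ring

theorem norm_Wk_Kdiag [NeZero L] (ε : ℝ) (θ : Λ L → ℝ) :
    ‖Wk (Kdiag L ε) θ‖ = |ε| * ∑ b : Bond L, (cur b θ) ^ 2 := by
  rw [Wk_Kdiag, norm_mul, Complex.norm_I, mul_one, Complex.norm_real, Real.norm_eq_abs, abs_mul]
  congr 1
  exact abs_of_nonneg (Finset.sum_nonneg fun b _ => sq_nonneg (cur b θ))

/-- The 90°-helix `θ_x = (π/2)(x₀ + x₁ + x₂)` (representatives `val ∈ {0,…,L-1}`). -/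
def helix (L : ℕ) (x : Λ L) : ℝ := Real.pi / 2 * (((x 0).val + (x 1).val + (x 2).val : ℕ) : ℝ)

/-- One step in `ZMod L`: the representative moves by `+1` or wraps by `-(L-1)`. -/
theorem val_add_one_cases [NeZero L] (hL : 2 ≤ L) (a : ZMod L) :
    (a + 1).val = a.val + 1 ∨ (a + 1).val + L = a.val + 1 := by
  haveI : Fact (1 < L) := ⟨hL⟩
  rw [ZMod.val_add, ZMod.val_one]
  have ha := ZMod.val_lt a
  rcases Nat.lt_or_ge (a.val + 1) L with h | h
  · left; exact Nat.mod_eq_of_lt h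
  · right
    have : a.val + 1 = L := le_antisymm ha h
    rw [this, Nat.mod_self]; omega

/-- On the helix every current equals `1` when `4 ∣ L` (the wrap-around step is `1 - L ≡ 1 mod 4`).
-/
theorem cur_helix [NeZero L] (hL : 2 ≤ L) (h4 : 4 ∣ L) (b : Bond L) : cur b (helix L) = 1 := by
  obtain ⟨x, i⟩ := b
  obtain ⟨m, hm⟩ := h4
  -- the increment of the representative sum along direction `i`
  have hstep : ∀ a : ZMod L, Real.sin (Real.pi / 2 * (((a + 1).val : ℝ) - (a.val : ℝ))) = 1 := by
    intro a
    rcases val_add_one_cases hL a with h | h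
    · rw [h]; push_cast
      rw [show Real.pi / 2 * ((a.val : ℝ) + 1 - (a.val : ℝ)) = Real.pi / 2 by ring]
      exact Real.sin_pi_div_two
    · have h' : ((a + 1).val : ℝ) - (a.val : ℝ) = 1 - (L : ℝ) := by
        have := congrArg (fun n : ℕ => (n : ℝ)) h; push_cast at this; linarith
      rw [h', hm]; push_cast
      have : Real.pi / 2 * (1 - 4 * (m : ℝ)) = Real.pi / 2 - (m : ℕ) * (2 * Real.pi) := by ring
      rw [this, Real.sin_sub_nat_mul_two_pi]; exact Real.sin_pi_div_two
  have h10 : (1 : Fin 3) ≠ 0 := by decide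
  have h20 : (2 : Fin 3) ≠ 0 := by decide
  have h21 : (2 : Fin 3) ≠ 1 := by decide
  unfold cur
  fin_cases i
  · show Real.sin (helix L (x + Pi.single (0 : Fin 3) 1) - helix L x) = 1
    have e0 : (x + Pi.single (0 : Fin 3) (1 : ZMod L) : Λ L) 0 = x 0 + 1 := by simp
    have e1 : (x + Pi.single (0 : Fin 3) (1 : ZMod L) : Λ L) 1 = x 1 := by simp [h10]
    have e2 : (x + Pi.single (0 : Fin 3) (1 : ZMod L) : Λ L) 2 = x 2 := by simp [h20]
    simp only [helix, e0, e1, e2]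
    convert hstep (x 0) using 2
    push_cast; ring
  · show Real.sin (helix L (x + Pi.single (1 : Fin 3) 1) - helix L x) = 1
    have e0 : (x + Pi.single (1 : Fin 3) (1 : ZMod L) : Λ L) 0 = x 0 := by simp [h10.symm]
    have e1 : (x + Pi.single (1 : Fin 3) (1 : ZMod L) : Λ L) 1 = x 1 + 1 := by simp
    have e2 : (x + Pi.single (1 : Fin 3) (1 : ZMod L) : Λ L) 2 = x 2 := by simp [h21]
    simp only [helix, e0, e1, e2]
    convert hstep (x 1) using 2
    push_cast; ring
  · show Real.sin (helix L (x + Pi.single (2 : Fin 3) 1) - helix L x) = 1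
    have e0 : (x + Pi.single (2 : Fin 3) (1 : ZMod L) : Λ L) 0 = x 0 := by simp [h20.symm]
    have e1 : (x + Pi.single (2 : Fin 3) (1 : ZMod L) : Λ L) 1 = x 1 := by simp [h21.symm]
    have e2 : (x + Pi.single (2 : Fin 3) (1 : ZMod L) : Λ L) 2 = x 2 + 1 := by simp
    simp only [helix, e0, e1, e2]
    convert hstep (x 2) using 2
    push_cast; ring

/-- EXTENSIVENESS (tightness of every sup-norm estimate): for `4 ∣ L` the admissible kernel
`Kdiag` reaches `‖W_K(helix)‖ = 3 |ε| L³`. Hence `e^{W_K}` is NOT uniformly close to `1`,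
`|Z_K/Z_0 - 1|` admits no termwise bound, and conjunct 1 can only follow from cancellations
(a convergent expansion of `log (Z_K/Z_0)`), cf. §3 and §5.1–5.5. -/
theorem norm_Wk_Kdiag_helix [NeZero L] (hL : 2 ≤ L) (h4 : 4 ∣ L) (ε : ℝ) :
    ‖Wk (Kdiag L ε) (helix L)‖ = 3 * |ε| * (L : ℝ) ^ 3 := by
  rw [norm_Wk_Kdiag]
  simp only [cur_helix hL h4, one_pow, Finset.sum_const, Finset.card_univ, nsmul_eq_mul, mul_one,
    Fintype.card_prod, Fintype.card_fin, Fintype.card_fun, ZMod.card]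
  push_cast
  ring

theorem exists_norm_Wk_ge [NeZero L] (hL : 2 ≤ L) (h4 : 4 ∣ L) {ε : ℝ} (hε : 0 ≤ ε) :
    ∃ K : Bond L → Bond L → ℂ, Admissible L ε K ∧ ∃ θ : Λ L → ℝ, ‖Wk K θ‖ = 3 * ε * (L : ℝ) ^ 3 :=
  ⟨Kdiag L ε, admissible_Kdiag hε, helix L, by rw [norm_Wk_Kdiag_helix hL h4, abs_of_nonneg hε]⟩


/-! ## §3 Natural strengthenings that are FALSE (what a proof must NOT try to show)

* "`‖e^{W_K} - 1‖` small uniformly" / "`Z_K / Z_0 → 1`": FALSE — `W_K` is extensive.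
  For the admissible imaginary diagonal kernel `K = iε δ_{bb'}`, `W_K(θ) = iε Σ_b sin²(∇_b θ)`
  reaches `‖W_K‖ = 3 ε L³` on the 90°-helix (all currents `= 1`, `4 ∣ L`), and under the Gibbs
  measure `Im W_K` has mean `≈ 3 ε L³ ⟨sin²∇θ⟩ ~ ε L³/J` and variance `~ ε² L³/J²`, so
  `|Z_K/Z_0| = |E_J e^{W_K}| ≈ exp(-ε² Var/2)` is EXPONENTIALLY SMALL IN THE VOLUME (MC numbers in
  §4). Zero-freeness must come from a convergent expansion of `log(Z_K/Z_0)` (cluster/RG), never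
  from smallness of `e^{W} - 1`.
* "plateau is `1`-Lipschitz in `K` uniformly in `L` in operator norm of the complex density":
  meaningless for complex weights — `|num/Z|/L⁶` is not bounded by `sup |cos| = 1` once the
  weight is complex; only the RATIO after cancellation is `m₀² + O(ε)` (cumulant expansion, §5).
* "the bound holds for every `J ≥ 0`": FALSE (§2 `AllJ`).
* "exponent 3 suffices": FALSE (§2 `Exp`).

## §4 Numerics (small-model computation; reweighting Monte Carlo, kit jobs)

Checkerboard Metropolis + over-relaxation for the unperturbed 3D XY measure, reweighted to the
extreme admissible kernels `K = c·k`, `|c| ≤ ε` (16 phases of `c`, `ε ∈ {0.05,…,1}`), `k ∈ {A =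
δ_{bb'}, B = (1+d)⁻⁴ all pairs, C = (1+d)⁻⁴ δ_{ii'}, D = (1+d)⁻⁴ × staggered signs}`; recorded:
`|Z_K/Z_0| / E|e^{W}|` (cancellation), the plateau `P = Re(num/Z)/L⁶`, bootstrap errors.
RESULTS (kit j007909, smoke: `L ∈ {4,6}`, `J ∈ {1,2}`, 10³ samples/pt; table `mc_smoke_table.md`
attached to the item):
* GAUSSIAN LAW CONFIRMED: on the imaginary axis `c = iε`, `|Z_K/Z_0| = exp(-ε² Var Q/2)` to the
  third decimal wherever resolvable (e.g. `L=4,J=1,A: 0.943/0.943, 0.790/0.791, 0.382/0.391`;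
  `B: 0.825/0.825, 0.463/0.464`; `D: 0.754/0.753, 0.329/0.321`; `L=6,J=2,A: 0.705/0.708`; max
  `|log(meas/Gauss)| = 0.13` over all resolved imaginary-axis points). `Var Q / L³ ≈ 0.73 (A,C),
  2.4 (B), 3.5 (D)` at `J = 1` and `≈ 0.32, 1.0, 1.4` at `J = 2` (∝ `J⁻²`, spin-wave scaling) —
  i.e. `L⁻³ log|Z_K/Z_0| = -ε² (Var Q/L³)/2 + …`: extensive, quadratic, analytic in `ε`, §5.3.
* PLATEAU: over the 614/1536 resolved scan points (`|R|` and its Gaussian prediction above the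
  estimator floor `3/√N`, ess > 200) `max |P - m₀²| = 0.075`, and `≤ 0.005` for `ε ≤ 0.1`;
  `Im P ≈ -0.25 ε` (A, `L=4,J=1`), linear in `ε` as the first joint cumulant predicts.
* INTRINSIC BLINDNESS: `|Z_K/Z_0| ~ exp(-ε² c L³/J²)` drops below any sampling floor as soon as
  `ε √Var Q ≳ 2.5`; all "strong cancellation" entries of the raw log are noise-floor artefacts
  (`|R| < 3/√N`), and ratios `P` there are meaningless. Reweighting numerics can never reach the
  regime where a zero of `Z_K` could sit (§5.2) — consistent with "no certificate route".
* Follow-ups queued (auto-attach to the item): j009085 (`L ≤ 10`, 8·10³ samples), j013776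
  (noise-floor-aware analysis, 2·10⁴ samples, `L ≤ 8`, `J ∈ {1,2,4}`).

## §5 WHY IT RESISTS (briefing for provers and later refuter cycles)

1. ENERGETICS ARE DEFUSED BY THE QUANTIFIER ORDER. `norm_Wk_le_energy` + `sq_cur_le`:
   `|W_K| ≤ 2 ε D_L · Σ_b (1 - cos ∇_b θ) = (2 ε D_L / J) · H_J(θ)`, `D_L ≤ 3 S_∞ ≈ 7.4`. Every
   competing state (spiral `q`: gain `ε S_L sin² q` vs cost `J (1 - cos q)` per site; staggered
   currents: cost `O(J)` per bond; vortex lines: `e^{-cJ·length}` vs `e^{O(ε)·length}`; winding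
   sectors: `e^{-2π² k² J L}` vs `e^{O(ε L)}`) loses once `J₀ ≥ C ε`. The prover chooses `J₀` after
   nothing and together with `ε`.
2. NO SYMMETRY ZERO. `W_K` is a quadratic form in the currents: even under `θ ↦ -θ`, invariant
   under global rotations, and `W_K = 0` on constant configurations. Every measure-preserving
   symmetry of `w_J dθ` (O(2) × torus automorphisms) maps constants to constants, so no symmetry
   `τ` can satisfy `e^{W∘τ} = -e^{W}`; an exact zero of `Z_K` can only be a fine-tuned
   cancellation at `L ≳ (ε S_∞)^{-1/3}` (`Zk_ne_zero_of_small` excludes smaller `L`), i.e. a zero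
   of an `L³`-dimensional oscillatory integral — nothing a computation can certify.
3. GAUSSIAN (SPIN-WAVE) CARICATURE IS ZERO-FREE. With `j_b ≈ ∇_b θ`, a translation-invariant
   admissible `K` shifts the stiffness `J |q|² ↦ J|q|² + 2 q·k̂(q)·q`, `|k̂| ≤ ε S_∞ ≪ J`: the
   complex Gaussian integral never vanishes and `⟨cos(θ_x-θ_y)⟩` changes by a factor
   `exp(O(ε/J²))` — plateau `m₀² + O(ε/J²)`, real part positive. Joint cumulants
   `κ(|m|², Qⁿ) = O(J^{-n-1})` are IR-finite in `d = 3` (sums `Σ_k k^{2n}/(Jk²)^{n+1}`).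
4. INDEPENDENT-BOND CARICATURE: zeros of `z ↦ ∫_0^{2π} e^{J cos φ + z sin² φ} dφ` sit at
   `|z| ≳ J` (the `φ = 0` saddle dominates the `φ = π` saddle by `e^{2J}`), far outside `|z| ≤ ε`.
5. HADAMARD (kill criterion K3) IS NOT A KILL: `z ↦ E_J[e^{z Q}]` (diagonal kernel) is entire of
   exponential type `≤ 3L³` and not of the form `e^{αz}`, so it HAS zeros — but their location is
   what matters, and 3–4 put the nearest at distance `~J`, not `~ε`, in every tractable
   caricature. What is missing for a proof is uniformity in `L` (convergent cluster/RG expansion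
   for a complex, non-local, gradient-coupled perturbation of the massless ordered phase:
   Balaban 1995–98 / Balaban–O'Carroll 1999 technology extended to complex `(1+d)⁻⁴` kernels).
6. LITERATURE / IR STRUCTURE: no negative result in print for O(2)-invariant complex
   perturbations in the ordered phase. Lee–Yang pinching at `h = 0` below `T_c` needs a
   perturbation that distinguishes the pure states (odd under O(2)); the Goldstone
   non-analyticity (`m(h) - m(0) ~ h^{1/2}`, divergent longitudinal susceptibility
   `Σ_x ⟨s₀ᴸ; s_xᴸ⟩ ~ Σ |x|^{-2(d-2)} = ∞` in `d = 3`) needs an observable referencing the global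
   direction. `W_K` is built from nearest-neighbour DIFFERENCES: in spin-wave theory
   `⟨j_b ; j_{b'}⟩ ~ |x|^{-d}`, so every cumulant `κ_n(W_K)` and `κ(|m|², W_Kⁿ)` per volume is an
   absolutely convergent lattice sum (`|x|^{-2d}` and better) — the formal perturbation series of
   `L⁻³ log(Z_K/Z_0)` and of the plateau in `ε` has FINITE coefficients at every order, uniformly
   in `L`. There is no perturbative (infrared) obstruction; what is unproved is only convergence /
   Borel-type control (large fields, vortices) — Balaban's regime. Fisher zeros of 3D XY pinch the
   real `J` axis only at `J_c` (§2 AllJ).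
7. WHAT WOULD KILL IT (for later cycles): (a) an admissible complex `K` whose perturbed
   transfer/cluster expansion provably diverges in the ordered phase uniformly — none known;
   (b) a rigorous Fisher-zero result placing zeros of an energy-like perturbation near the real
   axis for `J > J_c` — would contradict the expected analyticity of the low-T phase in thermal
   perturbations, itself open (BFLLS 1981: the spin-wave expansion is only known asymptotic);
   (c) a defect in the Lean vocabulary — none found (read-back in NOTES; `Iff.rfl` restatement).
-/

/-! ## Targets
None at cycle 1 (no line picked, no skeleton, `stuck_stubs = []`). -/

end

end Summit.HubbardSuperconductivity.HubbardSuperconductivity.Cruxes.PerturbedXYOrder.Disproof
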